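import Literature.Analysis.FluidPDE.TaoAveragedSlotMeasurable
import Literature.Analysis.FluidPDE.TaoAveragedSlotBounds
import HarnessLib

/-!
# Tao's averaged Navier–Stokes blow-up: absolute convergence of (3.4) and the discharge of `complexAverage_linear_right`

T. Tao, *Finite time blowup for an averaged three-dimensional Navier–Stokes equation*,
J. Amer. Math. Soc. **29** (2016), 601–674 = arXiv:1402.0290v3 (held as `paper:arxiv-1402.0290`;
all numbers are those of that text), §1.1 p. 7: "A similar argument shows that the expectation in
(1.12) (or the integral in (1.13)) is absolutely convergent for any `u, v, w ∈ H¹⁰_df(ℝ³)`" — by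
duality, Minkowski's inequality, the boundedness of order-`0` multipliers, rotations and
dilations with `λ ∈ [C⁻¹, C]` on `H¹⁰` (p. 6) and the moment bounds; and §3.1 Def. 3.4, p. 15:
complex averages (3.4) under the integrability conditions (3.5).

This file discharges the named fact
`Literature.Analysis.FluidPDE.Tao2016.complexAverage_linear_right`
(`TaoAveragedComplexAverage.lean`): **a complex average of the Euler bilinear operator `B` is
`ℂ`-linear in `w` on `H¹⁰_df ⊗ ℂ`**. The vendored `ComplexAveragingDatum.average` is a Bochner
integral over `Ω` of Bochner integrals over `ℝ³ × ℝ³` ((1.3)), so linearity is exactly the absolute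
convergence Tao asserts, which is assembled here from the four accepted support files:

* `TaoAveragedSlotFourier.lean` — the slots `A_{i,ω} = m_{i,ω}(D) Rot_{R_{i,ω}} Dil_{λ_{i,ω}}` are
  `ℂ`-linear (`ComplexAveragingDatum.slot_add_smul` below) and their Fourier transforms are explicit;
* `TaoAveragedEulerFormBound.lean` — `|⟨B(u',v'), w'⟩| ≤ 2πC ‖u'‖_{H¹⁰} ‖v'‖_{H¹⁰} ‖w'‖_{L²}` and
  `⟨B(u',v'), ·⟩` is linear on `L²` for `u', v' ∈ H¹⁰`;
* `TaoAveragedSlotBounds.lean` — `‖A_{i,ω} x‖_{H¹⁰} ≤ ‖m_{i,ω}‖₀ max(1,λ_{i,ω})^{10} ‖x‖_{H¹⁰}`,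
  `‖A_{i,ω} x‖_{L²} ≤ ‖m_{i,ω}‖₀ ‖x‖_{L²}`;
* `TaoAveragedSlotMeasurable.lean` — `ω ↦ ⟨B(A_{1,ω}u, A_{2,ω}v), A_{3,ω}w⟩` is measurable.

Hence (`ComplexAveragingDatum.enorm_eulerForm_slot_le`) the integrand of (3.4) for `C' = B` is
bounded by `K(u,v,w,C₀) · ‖m_{1,ω}‖₀ ‖m_{2,ω}‖₀ ‖m_{3,ω}‖₀`, integrable by (3.5) with
`k₁ = k₂ = k₃ = 0` (`ComplexAveragingDatum.integrable_eulerForm_slot`: **absolute convergence of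
(3.4)/(1.13)** for `u, v ∈ H¹⁰`, `w ∈ L²`), and `complexAverage_linear_right_holds` follows by
linearity of the two integrals. (Divergence-freeness of the arguments is not needed; only the
`H¹⁰` bounds on `u, v` and `w ∈ L²`.)

## References

* T. Tao, J. Amer. Math. Soc. 29 (2016), 601–674, arXiv:1402.0290v3, §1.1 pp. 6–7 ((1.10)–(1.13)),
  §3.1 Def. 3.4 (3.4)–(3.5) p. 15. Key `Tao2016AveragedNS`.
-/

noncomputable section

open MeasureTheory Set Filter Topology FourierTransform Complex
open scoped ENNReal NNReal

namespace Literature.Analysis.FluidPDE.Tao2016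

namespace ComplexAveragingDatum

variable (𝒟 : ComplexAveragingDatum)

/-- **The slots of a complex average are `ℂ`-linear** on `L²`:
`A_{i,ω}(a x + b y) = a A_{i,ω} x + b A_{i,ω} y` (`m(D)`, `Rot_R`, `Dil_λ` are linear). [cite: Tao2016AveragedNS, Def. 3.4] -/
theorem slot_add_smul (i : Fin 3) (θ : 𝒟.Ω) (a b : ℂ) (x y : L2C) :
    𝒟.slot i θ (a • x + b • y) = a • 𝒟.slot i θ x + b • 𝒟.slot i θ y := by
  simp only [slot, dil_add, dil_smul, rot_add, rot_smul, fourierMultiplier_add,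
    fourierMultiplier_smul]

/-- **Pointwise bound for the integrand of (3.4) with `C' = B`**: if `λ_{i,ω} ≤ C` then
`|⟨B(A_{1,ω} u, A_{2,ω} v), A_{3,ω} w⟩| ≤ π · 2C_emb · (max(1,C)^{10} ‖u‖_{H¹⁰}) (max(1,C)^{10} ‖v‖_{H¹⁰}) ‖w‖_{L²} · ‖m_{1,ω}‖₀ ‖m_{2,ω}‖₀ ‖m_{3,ω}‖₀`
(Tao p. 7, "duality, the triangle inequality … and the Hörmander–Mikhlin multiplier theorem":
here Plancherel-side bounds, `C_emb = (∫ (1+|ξ|²)^{-10})^{1/2}`). [cite: Tao2016AveragedNS, §1.1 p. 7 and Def. 3.4] -/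
theorem enorm_eulerForm_slot_le {C : ℝ} (hC : ∀ i θ, 𝒟.lam i θ ≤ C) (u v w : L2C) (θ : 𝒟.Ω) :
    ‖eulerForm (𝒟.slot 0 θ u) (𝒟.slot 1 θ v) (𝒟.slot 2 θ w)‖ₑ ≤
      ENNReal.ofReal Real.pi * (2 *
        (∫⁻ ξ : EuclideanSpace ℝ (Fin 3), ENNReal.ofReal ((1 + ‖ξ‖ ^ 2) ^ (-10 : ℝ))) ^ (1 / 2 : ℝ) *
        (ENNReal.ofReal (max 1 C ^ (10 : ℝ)) * FunctionSpaces.eFourierSobolevNorm 10 u) *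
        (ENNReal.ofReal (max 1 C ^ (10 : ℝ)) * FunctionSpaces.eFourierSobolevNorm 10 v) * ‖w‖ₑ) *
        (symbolSeminorm 0 (𝒟.m 0 θ) * symbolSeminorm 0 (𝒟.m 1 θ) * symbolSeminorm 0 (𝒟.m 2 θ)) := by
  have hK : ∀ i, ENNReal.ofReal (max 1 (𝒟.lam i θ) ^ (10 : ℝ)) ≤ ENNReal.ofReal (max 1 C ^ (10 : ℝ)) :=
    fun i => ENNReal.ofReal_le_ofReal
      (Real.rpow_le_rpow (by positivity) (max_le_max le_rfl (hC i θ)) (by norm_num))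
  have h0 : FunctionSpaces.eFourierSobolevNorm 10 (𝒟.slot 0 θ u) ≤ symbolSeminorm 0 (𝒟.m 0 θ) *
      (ENNReal.ofReal (max 1 C ^ (10 : ℝ)) * FunctionSpaces.eFourierSobolevNorm 10 u) := by
    refine (𝒟.eFourierSobolevNorm_slot_le 0 θ (by norm_num : (0 : ℝ) ≤ 10) u).trans ?_
    rw [mul_assoc]
    exact mul_le_mul' le_rfl (mul_le_mul' (hK 0) le_rfl)
  have h1 : FunctionSpaces.eFourierSobolevNorm 10 (𝒟.slot 1 θ v) ≤ symbolSeminorm 0 (𝒟.m 1 θ) *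
      (ENNReal.ofReal (max 1 C ^ (10 : ℝ)) * FunctionSpaces.eFourierSobolevNorm 10 v) := by
    refine (𝒟.eFourierSobolevNorm_slot_le 1 θ (by norm_num : (0 : ℝ) ≤ 10) v).trans ?_
    rw [mul_assoc]
    exact mul_le_mul' le_rfl (mul_le_mul' (hK 1) le_rfl)
  have h2 := 𝒟.enorm_slot_le 2 θ w
  calc ‖eulerForm (𝒟.slot 0 θ u) (𝒟.slot 1 θ v) (𝒟.slot 2 θ w)‖ₑ
      ≤ ENNReal.ofReal Real.pi * (2 *
          (∫⁻ ξ : EuclideanSpace ℝ (Fin 3), ENNReal.ofReal ((1 + ‖ξ‖ ^ 2) ^ (-10 : ℝ))) ^ (1 / 2 : ℝ) *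
          FunctionSpaces.eFourierSobolevNorm 10 (𝒟.slot 0 θ u) *
          FunctionSpaces.eFourierSobolevNorm 10 (𝒟.slot 1 θ v) * ‖𝒟.slot 2 θ w‖ₑ) :=
        enorm_eulerForm_le _ _ _
    _ ≤ ENNReal.ofReal Real.pi * (2 *
          (∫⁻ ξ : EuclideanSpace ℝ (Fin 3), ENNReal.ofReal ((1 + ‖ξ‖ ^ 2) ^ (-10 : ℝ))) ^ (1 / 2 : ℝ) *
          (symbolSeminorm 0 (𝒟.m 0 θ) *
            (ENNReal.ofReal (max 1 C ^ (10 : ℝ)) * FunctionSpaces.eFourierSobolevNorm 10 u)) *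
          (symbolSeminorm 0 (𝒟.m 1 θ) *
            (ENNReal.ofReal (max 1 C ^ (10 : ℝ)) * FunctionSpaces.eFourierSobolevNorm 10 v)) *
          (symbolSeminorm 0 (𝒟.m 2 θ) * ‖w‖ₑ)) := by
        gcongr
    _ = _ := by ring

/-- **Absolute convergence of (3.4) (and of (1.13)) for `C' = B`**: for a complex averaging datum,
`u, v ∈ L²` with finite `H¹⁰` norm and `w ∈ L²`, the integrand
`ω ↦ ⟨B(A_{1,ω} u, A_{2,ω} v), A_{3,ω} w⟩` is integrable on `(Ω, μ)` (Tao p. 7: "the expectation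
in (1.12) (or the integral in (1.13)) is absolutely convergent for any `u, v, w ∈ H¹⁰_df`"; by the
pointwise bound and the integrability condition (3.5) with `k₁ = k₂ = k₃ = 0`). [cite: Tao2016AveragedNS, §1.1 p. 7 and Def. 3.4 (3.5)] -/
theorem integrable_eulerForm_slot {u v : L2C} (w : L2C)
    (hu : FunctionSpaces.eFourierSobolevNorm 10 u < ∞) (hv : FunctionSpaces.eFourierSobolevNorm 10 v < ∞) :
    Integrable (fun θ => eulerForm (𝒟.slot 0 θ u) (𝒟.slot 1 θ v) (𝒟.slot 2 θ w)) 𝒟.μ := by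
  obtain ⟨C, hC⟩ := 𝒟.lam_bdd
  refine ⟨𝒟.aestronglyMeasurable_eulerForm_slot u v w, ?_⟩
  set K : ℝ≥0∞ := ENNReal.ofReal Real.pi * (2 *
    (∫⁻ ξ : EuclideanSpace ℝ (Fin 3), ENNReal.ofReal ((1 + ‖ξ‖ ^ 2) ^ (-10 : ℝ))) ^ (1 / 2 : ℝ) *
    (ENNReal.ofReal (max 1 C ^ (10 : ℝ)) * FunctionSpaces.eFourierSobolevNorm 10 u) *
    (ENNReal.ofReal (max 1 C ^ (10 : ℝ)) * FunctionSpaces.eFourierSobolevNorm 10 v) * ‖w‖ₑ) with hK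
  have hKtop : K < ∞ := by
    refine ENNReal.mul_lt_top ENNReal.ofReal_lt_top (ENNReal.mul_lt_top (ENNReal.mul_lt_top
      (ENNReal.mul_lt_top (ENNReal.mul_lt_top ENNReal.ofNat_lt_top ?_)
      (ENNReal.mul_lt_top ENNReal.ofReal_lt_top hu)) (ENNReal.mul_lt_top ENNReal.ofReal_lt_top hv))
      enorm_lt_top)
    exact ENNReal.rpow_lt_top_of_nonneg (by norm_num) lintegral_inv_sobolevWeight_lt_top.ne
  calc ∫⁻ θ, ‖eulerForm (𝒟.slot 0 θ u) (𝒟.slot 1 θ v) (𝒟.slot 2 θ w)‖ₑ ∂𝒟.μ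
      ≤ ∫⁻ θ, K * (symbolSeminorm 0 (𝒟.m 0 θ) * symbolSeminorm 0 (𝒟.m 1 θ) *
          symbolSeminorm 0 (𝒟.m 2 θ)) ∂𝒟.μ :=
        lintegral_mono fun θ => 𝒟.enorm_eulerForm_slot_le (fun i θ => (hC i θ).2) u v w θ
    _ = K * ∫⁻ θ, symbolSeminorm 0 (𝒟.m 0 θ) * symbolSeminorm 0 (𝒟.m 1 θ) *
          symbolSeminorm 0 (𝒟.m 2 θ) ∂𝒟.μ := lintegral_const_mul' K _ hKtop.ne
    _ < ∞ := ENNReal.mul_lt_top hKtop (𝒟.moment 0 0 0)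

/-- The `H¹⁰` norm of a slot applied to an `H¹⁰` field is finite. [cite: Tao2016AveragedNS, §1.1 p. 6] -/
theorem eFourierSobolevNorm_slot_lt_top (i : Fin 3) (θ : 𝒟.Ω) {u : L2C}
    (hu : FunctionSpaces.eFourierSobolevNorm 10 u < ∞) :
    FunctionSpaces.eFourierSobolevNorm 10 (𝒟.slot i θ u) < ∞ :=
  lt_of_le_of_lt (𝒟.eFourierSobolevNorm_slot_le i θ (by norm_num : (0 : ℝ) ≤ 10) u)
    (ENNReal.mul_lt_top (ENNReal.mul_lt_top ((𝒟.isComplexSymbol i θ).2 0) ENNReal.ofReal_lt_top) hu)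

/-- **The integrand of (3.4) is `ℂ`-linear in `w`, pointwise in `ω`**, for `u, v ∈ H¹⁰` and
`w₁, w₂ ∈ L²`. [cite: Tao2016AveragedNS, Def. 3.4] -/
theorem eulerForm_slot_add_smul (θ : 𝒟.Ω) {u v : L2C} (w₁ w₂ : L2C) (a b : ℂ)
    (hu : FunctionSpaces.eFourierSobolevNorm 10 u < ∞) (hv : FunctionSpaces.eFourierSobolevNorm 10 v < ∞) :
    eulerForm (𝒟.slot 0 θ u) (𝒟.slot 1 θ v) (𝒟.slot 2 θ (a • w₁ + b • w₂)) =
      a * eulerForm (𝒟.slot 0 θ u) (𝒟.slot 1 θ v) (𝒟.slot 2 θ w₁) +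
        b * eulerForm (𝒟.slot 0 θ u) (𝒟.slot 1 θ v) (𝒟.slot 2 θ w₂) := by
  rw [slot_add_smul]
  exact eulerForm_add_smul_right_of_sobolev _ _ a b (𝒟.eFourierSobolevNorm_slot_lt_top 0 θ hu)
    (𝒟.eFourierSobolevNorm_slot_lt_top 1 θ hv)

/-- **A complex average of `B` is `ℂ`-linear in `w`** for `u, v ∈ L²` with finite `H¹⁰` norm and
`w₁, w₂ ∈ L²` (the hypotheses actually used). [cite: Tao2016AveragedNS, §1.1 p. 7 and Def. 3.4] -/
theorem average_eulerForm_add_smul {u v : L2C} (w₁ w₂ : L2C) (a b : ℂ)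
    (hu : FunctionSpaces.eFourierSobolevNorm 10 u < ∞) (hv : FunctionSpaces.eFourierSobolevNorm 10 v < ∞) :
    𝒟.average eulerForm u v (a • w₁ + b • w₂) =
      a * 𝒟.average eulerForm u v w₁ + b * 𝒟.average eulerForm u v w₂ := by
  unfold average
  rw [show (fun θ => eulerForm (𝒟.slot 0 θ u) (𝒟.slot 1 θ v) (𝒟.slot 2 θ (a • w₁ + b • w₂))) =
      fun θ => a * eulerForm (𝒟.slot 0 θ u) (𝒟.slot 1 θ v) (𝒟.slot 2 θ w₁) +
        b * eulerForm (𝒟.slot 0 θ u) (𝒟.slot 1 θ v) (𝒟.slot 2 θ w₂) from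
      funext fun θ => 𝒟.eulerForm_slot_add_smul θ w₁ w₂ a b hu hv,
    integral_add ((𝒟.integrable_eulerForm_slot w₁ hu hv).const_mul a)
      ((𝒟.integrable_eulerForm_slot w₂ hu hv).const_mul b),
    integral_const_mul, integral_const_mul]

end ComplexAveragingDatum

/-- **Discharge of `complexAverage_linear_right`** (Tao 2016, §1.1 p. 7 and Def. 3.4 (3.5)): for
every complex averaging datum `𝒟` and `u, v ∈ H¹⁰_df ⊗ ℂ`,
`w ↦ ∫_Ω ⟨B(m₁(D) Rot Dil u, m₂(D) Rot Dil v), m₃(D) Rot Dil w⟩ dμ` is `ℂ`-linear on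
`H¹⁰_df ⊗ ℂ` — because the slots are linear, the Euler form (1.3) converges absolutely for `H¹⁰`
arguments, and the `Ω`-integrand is integrable by the `H¹⁰`/`L²` bounds for multipliers,
rotations, dilations (p. 6) and the integrability condition (3.5) ("the integral in (1.13) is
absolutely convergent for any `u, v, w ∈ H¹⁰_df`", p. 7). [cite: Tao2016AveragedNS, §1.1 p. 7 and Def. 3.4 (3.5)] -/
theorem complexAverage_linear_right_holds : complexAverage_linear_right :=
  fun 𝒟 _ _ w₁ w₂ a b hu hv _ _ => 𝒟.average_eulerForm_add_smul w₁ w₂ a b hu.1 hv.1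

end Literature.Analysis.FluidPDE.Tao2016
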